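import Literature.NumberTheory.Automorphic.AutomorphicTwistHecke
import Literature.NumberTheory.Automorphic.ArchParameterTwistNorm
import Literature.NumberTheory.Automorphic.AutomorphicRepsGLOneHeckeCharacter
import Literature.NumberTheory.Automorphic.GLOneArchParameterClauses
import Literature.NumberTheory.Automorphic.AutomorphicRepsGLOneArchParameter
import Literature.NumberTheory.Automorphic.HarishChandraGLTwistComplex
import HarnessLib

/-!
# Twisting a cuspidal `GL_n` datum by a `GL₁` datum: Satake AND archimedean parameters
(crux `IrreducibilityBySelfDuality.RegularTwistCM`, item stmt-Langlands-14069, line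
`petersson-hermitian-purity`, stub `stub_twistRealisation`)

Let `K` be a number field, `π = W / W'` a cuspidal automorphic representation of `GL_n(𝔸_K)` and
`χ` one of `GL₁(𝔸_K)`, both in the Borel–Jacquet model of the tree (`CuspidalAutomorphicRepData`),
with archimedean parameters `P` and `ι ↦ {p ι}`. Then there is a cuspidal datum `π' = π ⊗ χ` on
`GL_n(𝔸_K)` with

* archimedean parameter `ι ↦ P ι + p ι` (every Harish-Chandra entry at `ι` shifted by `p ι`), and
* at almost every finite place `v`: whenever `π` has Satake parameter `β` at `v`, there is `c` with
  `{c}` the Satake parameter of `χ` at `v` and `c · β` that of `π'` (`c = θ(ϖ_v)`).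

Proof. The `GL₁` datum `χ` IS an idèle class character `θ` (`r(g) φ ≡ θ(det g) φ`,
`AutomorphicRepData.exists_heckeCharacter_glOne`; Gelbart 1975 §2.A), whose Satake parameters are
`{θ(ϖ_v)}` (`eventually_hasSatakeParamAt_glOne`) and whose archimedean parameter is read off the
differential `d` of `θ_∞` (`archParameter_clauses_glOne`, `heckeCharacter_glOne_det_ofArch_expMem`).
Put `π' = π ⊗ (θ ∘ det)` (`exists_cuspidalAutomorphicRepData_twist_hecke`; Borel–Jacquet 1979, 5.7).
Satake: `t_{π', v} = θ(ϖ_v) t_{π, v}` (`HasSatakeParamAt.map_mulChar_detTwist_hecke`; Arthur–Clozel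
1989, Ch. 3, p. 172). Archimedean: the Lie algebra acts on `π'` by `X ↦ X + δ(X)` along
`W / W' ≃ W·c / W'·c` with `δ` the differential of `θ ∘ det` (`lieRep_twist_hecke`), and on the factor
at a place `w`, `δ(ι_w Y) = d((tr Y)_w)` (`det ∘ exp = exp ∘ tr`); the Lie-level shift for an
ARBITRARY complex differential `Y ↦ L(tr Y)` is `HasHCParameter.of_twist_trace_real/complex`
(`Literature/NumberTheory/Automorphic/HarishChandraGLTwistComplex`; no unitarity, algebraicity or
finite order of `θ` is used).

References: A. Borel, H. Jacquet, Corvallis 1979, §5.7 [BorelJacquetCorvallis1979]; J. Arthur,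
L. Clozel, Ann. of Math. Stud. 120 (1989), Ch. 3, p. 172 [ArthurClozelAMS120]; K. Buzzard, T. Gee
(2014), §3.1 [BuzzardGee2014].
-/

open scoped BigOperators Classical ComplexConjugate MatrixGroups Matrix
open NumberField Filter IsDedekindDomain
open Literature.NumberTheory.Automorphic
open Literature.NumberTheory.GaloisRepresentations (HeckeCharacter ideleGroup localUnits)

-- `Summit.Langlands.Langlands.…` (problem = summit name) trips `dupNamespace` on every declaration.
set_option linter.dupNamespace false

-- Mathlib idiom (Mathlib/Algebra/Lie/OfAssociative.lean): the commutator bracket on matrices and on `End V`;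
-- needed to state Lie algebra representations `𝔤𝔩ₙ →ₗ⁅ℝ⁆ End V` (as in `HarishChandraGL`, `HarishChandraGLTwist`)
attribute [local instance 100] LieRing.ofAssociativeRing

noncomputable section

namespace Summit.Langlands.Langlands.Theorems.RegularTwistCM

open NumberField.InfinitePlace NumberField.mixedEmbedding

variable {n : ℕ} {K : Type} [Field K] [NumberField K] {hcpt : isCompact_glFiniteIntegralLevel n K}
  {h1 : isCompact_glFiniteIntegralLevel 1 K}

/-! ### `det (g, 1)` only depends on `det g ∈ K_∞`, across ranks -/

/-- **`det (g, 1) = det (g', 1)` in `𝕀_K` as soon as `det g = det g'` in `K_∞`**, for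
`g ∈ GL_m(K_∞)`, `g' ∈ GL_{m'}(K_∞)` of possibly different ranks (components `(det g, 1)`,
`coe_det_ofInfinite_fst/snd`). [folklore] -/
theorem det_ofInfinite_eq_of_det_eq' {m m' : ℕ} {g : GL (Fin m) (mixedSpace K)}
    {g' : GL (Fin m') (mixedSpace K)}
    (h : (g : Matrix (Fin m) (Fin m) (mixedSpace K)).det = (g' : Matrix (Fin m') (Fin m') (mixedSpace K)).det) :
    Matrix.GeneralLinearGroup.det (GLn.ofInfinite m K g) =
      Matrix.GeneralLinearGroup.det (GLn.ofInfinite m' K g') := by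
  refine Units.ext (Prod.ext ?_ ?_)
  · rw [coe_det_ofInfinite_fst, coe_det_ofInfinite_fst, h]
  · rw [coe_det_ofInfinite_snd, coe_det_ofInfinite_snd]

/-- `tr (a · 1₁) = a` on `1 × 1` matrices. [folklore] -/
theorem trace_smul_one_fin_one {R : Type*} [CommRing R] (a : R) :
    (a • (1 : Matrix (Fin 1) (Fin 1) R)).trace = a := by
  rw [Matrix.trace_smul, Matrix.trace_one, Fintype.card_fin, Nat.cast_one, smul_eq_mul, mul_one]

/-! ### The Lie algebra action on `π ⊗ (θ ∘ det)` for an arbitrary Hecke character `θ` -/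

namespace AutomorphicRepData

/-- **The Lie algebra acts on the twist `π ⊗ (θ ∘ det)` by `X ↦ X + δ(X)`**, `δ` the differential of
`θ ∘ det` along `𝔤 = 𝔤𝔩_n(K_∞)` (`θ(det (exp X, 1)) = e^{δ(X)}`,
`exists_linearMap_detTwist_ofArch_expMem_hecke`): along the quotient isomorphism `e : W / W' ≃ W·c / W'·c`
(`exists_quotEquiv_of_map_mulChar`) and for the Lie action `ρ` of `π`,
`π'.lieRep X (e v) = e (ρ X v + δ(X) v)`, because `X (c φ) = c (X φ + δ(X) φ)`
(`lieDeriv_mulChar_of_exp`). The case `θ = ‖·‖^s` is the tree's `lieRep_mulChar_twist`.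
Borel–Jacquet 1979, §1.5, 4.6 and 5.7. [cite: BorelJacquetCorvallis1979, 5.7] -/
theorem lieRep_twist_hecke (θ : HeckeCharacter K)
    {π π' : AutomorphicRepData (AutomorphyDatum.gl n K hcpt)}
    (hW : π'.W = π.W.map (mulChar (detTwist n θ)))
    {e : π.Quot ≃ₗ[ℂ] π'.Quot}
    (he : ∀ φ : π.W,
      e (π.mkQ φ) = π'.mkQ ⟨mulChar (detTwist n θ) φ, hW ▸ Submodule.mem_map_of_mem φ.2⟩)
    {ρ : (AutomorphyDatum.gl n K hcpt).arch.lie →ₗ⁅ℝ⁆ Module.End ℂ π.Quot} (hρ : π.HasLieAction ρ)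
    {δ : (AutomorphyDatum.gl n K hcpt).arch.lie →ₗ[ℝ] ℂ}
    (hδ : ∀ X : (AutomorphyDatum.gl n K hcpt).arch.lie,
      ((detTwist n θ ((AutomorphyDatum.gl n K hcpt).ofArch
        ((AutomorphyDatum.gl n K hcpt).arch.expMem X)) : ℂˣ) : ℂ) = Complex.exp (δ X))
    (X : (AutomorphyDatum.gl n K hcpt).arch.lie) (v : π.Quot) :
    π'.lieRep X (e v) = e (ρ X v + δ X • v) := by
  induction v using Submodule.Quotient.induction_on with
  | H φ =>
  have hmk : (Submodule.Quotient.mk φ : π.Quot) = π.mkQ φ := rfl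
  have hmem : ∀ ψ : π.W, mulChar (detTwist n θ) ψ ∈ π'.W := fun ψ =>
    hW ▸ Submodule.mem_map_of_mem ψ.2
  have hL : π'.lieRep X (e (π.mkQ φ)) =
      π'.mkQ (π'.lieDerivW X ⟨mulChar (detTwist n θ) φ, hmem φ⟩) := by
    rw [he]
    exact π'.lieRep_mkQ X _
  have h5 : ρ X (π.mkQ φ) + δ X • π.mkQ φ = π.mkQ (π.lieDerivW X φ + δ X • φ) := by
    rw [hρ X φ, (π.mkQ).map_add, (π.mkQ).map_smul]
  rw [hmk, hL, h5, he]
  congr 1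
  have key : lieDeriv (AutomorphyDatum.gl n K hcpt).ofArch X
      (mulChar (detTwist n θ) (φ : (AdelicGroupData.gl n K).Adelic → ℂ)) =
      mulChar (detTwist n θ) ((π.lieDerivW X φ + δ X • φ : π.W) :
        (AdelicGroupData.gl n K).Adelic → ℂ) := by
    haveI : FiniteDimensional ℝ (mixedSpace K) := inferInstance
    rw [lieDeriv_mulChar_of_exp _ hδ X (π.isArchSmooth_of_mem_W φ.2)]
    rfl
  exact Subtype.ext key

/-! ### The archimedean parameter of `π ⊗ χ` for a `GL₁` datum `χ` -/

/-- **The archimedean parameter of the twist of `π` by a `GL₁` datum.** Let `χ₁ = W₁ / W₁'` be an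
automorphic representation of `GL₁(𝔸_K)` with Hecke character `θ` (`r(g) φ - θ(det g) φ ∈ W₁'`) and
archimedean parameter `ι ↦ {p ι}`, and let `π'` be the twisted datum `π ⊗ (θ ∘ det)`
(`π'.W = c · W`, `π'.W' = c · W'`, `c = θ ∘ det`) of a datum `π` on `GL_n(𝔸_K)` with archimedean
parameter `P`. Then `π'` has archimedean parameter `ι ↦ P ι + p ι`. At a place `w` the differential
`δ` of `θ ∘ det` on `𝔤𝔩_n(K_w)` is `Y ↦ d((tr Y)_w)` for the differential `d` of `θ` on `𝔤𝔩₁(K_∞)`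
(`heckeCharacter_glOne_det_ofArch_expMem`, `det exp = exp tr`), the parameter `p` of `χ₁` at the
embeddings of `w` is `proj (a ↦ d(a_w)) τ 1` (`archParameter_clauses_glOne`), and the twist by
`Y ↦ L(tr Y)` shifts Harish-Chandra parameters by `proj L τ 1`
(`HasHCParameter.of_twist_trace_real/complex`). Borel–Jacquet 1979, 5.7; Buzzard–Gee 2014, §3.1;
Clozel 1990, §3.3. [cite: BorelJacquetCorvallis1979, 5.7] -/
theorem hasArchParameter_twist_glOne (χ₁ : AutomorphicRepData (AutomorphyDatum.gl 1 K h1))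
    {θ : HeckeCharacter K}
    (hθ : ∀ (g : (AdelicGroupData.gl 1 K).Adelic), ∀ φ ∈ χ₁.W,
      rightTranslation (AdelicGroupData.gl 1 K) g φ -
        ((θ (Matrix.GeneralLinearGroup.det g) : ℂˣ) : ℂ) • φ ∈ χ₁.W')
    {p : (K →+* ℂ) → ℂ} (hp : χ₁.HasArchParameter fun ι => {p ι})
    {π π' : AutomorphicRepData (AutomorphyDatum.gl n K hcpt)}
    (hW : π'.W = π.W.map (mulChar (detTwist n θ))) (hW' : π'.W' = π.W'.map (mulChar (detTwist n θ)))
    {P : (K →+* ℂ) → Multiset ℂ} (hP : π.HasArchParameter P) :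
    π'.HasArchParameter fun ι => (P ι).map (· + p ι) := by
  classical
  -- the `GL₁` side: the differential `d` of `θ` and the clauses of `p`
  obtain ⟨ρ₁, hρ₁⟩ := χ₁.exists_hasLieAction_gl
  obtain ⟨d, hd⟩ := χ₁.exists_linearMap_lieAction_eq_smul_one_glOne ρ₁
  obtain ⟨hre, hco⟩ := χ₁.archParameter_clauses_glOne hρ₁ d hd hp
  -- the `GL_n` side: the Lie action on the twist
  obtain ⟨ρ, hρ, hreal, hcx⟩ := hP
  obtain ⟨e, he⟩ :=
    Literature.NumberTheory.Automorphic.AutomorphicRepData.exists_quotEquiv_of_map_mulChar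
      (detTwist n θ) hW hW'
  obtain ⟨δ, -, hδ⟩ := exists_linearMap_detTwist_ofArch_expMem_hecke hcpt θ
  have hrel := fun X v => lieRep_twist_hecke θ hW he hρ hδ X v
  -- the differential of `θ ∘ det` on `GL_n` is the differential of `θ` on `GL₁` through the trace
  have hδd : ∀ (X : (AutomorphyDatum.gl n K hcpt).arch.lie) (Y : Matrix (Fin 1) (Fin 1) (mixedSpace K)),
      (X : Matrix (Fin n) (Fin n) (mixedSpace K)).trace = Y.trace → δ X = d ⟨Y, trivial⟩ := by
    intro X Y hXY
    refine eq_of_forall_cexp_mul_eq fun t => ?_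
    rw [← χ₁.heckeCharacter_glOne_det_ofArch_expMem hθ ⟨Y, trivial⟩
      (fun φ hφ => χ₁.lieDeriv_sub_smul_mem_of_hasLieAction_glOne hρ₁ hd _ hφ) t,
      ← Complex.real_smul, ← map_smul, ← hδ, detTwist_apply']
    congr 2
    rw [AutomorphyDatum.gl_ofArch_apply, AutomorphyDatum.gl_ofArch_apply, RealMatrixGroup.coe_expMem,
      RealMatrixGroup.coe_expMem]
    refine det_ofInfinite_eq_of_det_eq' ?_
    rw [coe_expGL, coe_expGL, Literature.Analysis.Matrix.det_exp_eq_exp_trace,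
      Literature.Analysis.Matrix.det_exp_eq_exp_trace]
    change NormedSpace.exp ((t • (X : Matrix (Fin n) (Fin n) (mixedSpace K))).trace) =
      NormedSpace.exp ((t • Y).trace)
    rw [Matrix.trace_smul, Matrix.trace_smul, hXY]
  refine ⟨π'.lieRep, π'.hasLieAction_lieRep, fun w => ?_, fun w => ?_⟩
  · -- real place `w`: the differential is `Y ↦ tr Y · d(1_w)`
    let L : ℝ →ₗ[ℝ] ℂ := d ∘ₗ
      ((LieSubalgebra.topEquiv.symm : Matrix (Fin 1) (Fin 1) (mixedSpace K) ≃ₗ⁅ℝ⁆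
          (⊤ : LieSubalgebra ℝ (Matrix (Fin 1) (Fin 1) (mixedSpace K)))).toLinearMap ∘ₗ
        (realPlaceLie 1 w).toLinearMap ∘ₗ
          (LinearMap.toSpanSingleton ℝ (Matrix (Fin 1) (Fin 1) ℝ) 1))
    have hL : ∀ a : ℝ, L a = d ⟨realPlaceLie 1 w (a • (1 : Matrix (Fin 1) (Fin 1) ℝ)), trivial⟩ :=
      fun a => rfl
    have hpw : p w.1.embedding = L 1 := by
      have h := hre w
      rw [Multiset.singleton_inj] at h
      rw [h, hL, one_smul]
    simp only [hpw]
    refine HasHCParameter.of_twist_trace_real L e (fun Y v => ?_) (hreal w)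
    simp only [LieHom.comp_apply]
    rw [hrel]
    congr 3
    refine (hδd _ (realPlaceLie 1 w (Y.trace • (1 : Matrix (Fin 1) (Fin 1) ℝ))) ?_).trans (hL _).symm
    change (realPlaceLie n w Y).trace = _
    rw [trace_realPlaceLie, trace_realPlaceLie, trace_smul_one_fin_one]
  · -- complex place `w`: the differential is `Y ↦ d((tr Y)_w)`
    let L : ℂ →ₗ[ℝ] ℂ := d ∘ₗ
      ((LieSubalgebra.topEquiv.symm : Matrix (Fin 1) (Fin 1) (mixedSpace K) ≃ₗ⁅ℝ⁆
          (⊤ : LieSubalgebra ℝ (Matrix (Fin 1) (Fin 1) (mixedSpace K)))).toLinearMap ∘ₗ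
        (complexPlaceLie 1 w).toLinearMap ∘ₗ
          ((LinearMap.toSpanSingleton ℂ (Matrix (Fin 1) (Fin 1) ℂ) 1).restrictScalars ℝ))
    have hL : ∀ a : ℂ, L a = d ⟨complexPlaceLie 1 w (a • (1 : Matrix (Fin 1) (Fin 1) ℂ)), trivial⟩ :=
      fun a => rfl
    have hpw : ∀ τ : ℂ →ₐ[ℝ] ℂ, p (τ.toRingHom.comp w.1.embedding) = HCEmb.proj L τ 1 := by
      intro τ
      have h := hco w τ
      rw [Multiset.singleton_inj] at h
      exact h
    simp only [hpw]
    refine HasHCParameter.of_twist_trace_complex L e (fun Y v => ?_) (hcx w)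
    simp only [LieHom.comp_apply]
    rw [hrel]
    congr 3
    refine (hδd _ (complexPlaceLie 1 w (Y.trace • (1 : Matrix (Fin 1) (Fin 1) ℂ))) ?_).trans (hL _).symm
    change (complexPlaceLie n w Y).trace = _
    rw [trace_complexPlaceLie, trace_complexPlaceLie, trace_smul_one_fin_one]

/-! ### Satake parameters of `π ⊗ χ` against those of the `GL₁` datum `χ` -/

/-- **Satake clause.** With `χ₁`, `θ`, `π`, `π' = π ⊗ (θ ∘ det)` as above (`n ≥ 1`): for all but
finitely many finite places `v`, every Satake parameter `β` of `π` at `v` gives a `c ∈ ℂ` (namely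
`θ(ϖ_v)` for a uniformizer `ϖ_v`) such that `{c}` is a Satake parameter of `χ₁` at `v`
(`eventually_hasSatakeParamAt_glOne`) and `c · β` one of `π'` (`HasSatakeParamAt.map_mulChar_detTwist_hecke`,
outside the level of `θ ∘ det`). Arthur–Clozel 1989, Ch. 3, proof of Thm. 3.1 (p. 172:
`t_{π ⊗ η, v} = η(ϖ_v) t_{π, v}`); Borel–Jacquet 1979, 4.6 and 5.7.
[cite: ArthurClozelAMS120, Ch. 3, proof of Thm. 3.1 (p. 172)] -/
theorem eventually_hasSatakeParamAt_twist_glOne (χ₁ : AutomorphicRepData (AutomorphyDatum.gl 1 K h1))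
    {θ : HeckeCharacter K}
    (hθ : ∀ (g : (AdelicGroupData.gl 1 K).Adelic), ∀ φ ∈ χ₁.W,
      rightTranslation (AdelicGroupData.gl 1 K) g φ -
        ((θ (Matrix.GeneralLinearGroup.det g) : ℂˣ) : ℂ) • φ ∈ χ₁.W')
    {π π' : AutomorphicRepData (AutomorphyDatum.gl n K hcpt)}
    (hW : π'.W = π.W.map (mulChar (detTwist n θ))) (hW' : π'.W' = π.W'.map (mulChar (detTwist n θ))) :
    ∀ᶠ v : HeightOneSpectrum (𝓞 K) in cofinite, ∀ β : Multiset ℂ, π.HasSatakeParamAt v β →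
      ∃ c : ℂ, χ₁.HasSatakeParamAt v {c} ∧ π'.HasSatakeParamAt v (β.map (fun b => c * b)) := by
  obtain ⟨𝔪, h𝔪, hθ𝔪⟩ := θ.exists_level n
  have hv1 : ∀ᶠ v : HeightOneSpectrum (𝓞 K) in cofinite, ¬ v.asIdeal ∣ 𝔪 := by
    rw [Filter.eventually_cofinite]
    simpa only [not_not] using Ideal.finite_factors h𝔪
  filter_upwards [hv1, χ₁.eventually_hasSatakeParamAt_glOne hθ] with v hv hχv β hβ
  obtain ⟨ϖ, hϖ, hS⟩ := hβ.map_mulChar_detTwist_hecke θ h𝔪 hθ𝔪 hv hW hW'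
  exact ⟨_, hχv ϖ hϖ, hS⟩

end AutomorphicRepData

/-! ### The registered stub -/

/-- **Stub `stub_twistRealisation`** of the line `petersson-hermitian-purity` for the crux
`RegularTwistCM` (**the twist `π ⊗ χ` of a cuspidal `GL_n` datum by a cuspidal `GL₁` datum, with its
Satake clause and its archimedean clause**). For `π` cuspidal on `GL_n(𝔸_K)` (`n ≥ 1`) with
archimedean parameter `P` and `χ` cuspidal on `GL₁(𝔸_K)` with archimedean parameter `ι ↦ {p ι}`
there is a cuspidal `π'` on `GL_n(𝔸_K)` with archimedean parameter `ι ↦ P ι + p ι` such that, for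
almost every `v` and every Satake parameter `β` of `π` at `v`, some `c` has `{c}` the Satake
parameter of `χ` and `c · β` that of `π'` at `v`. Proof: `χ` is a Hecke character `θ`
(`exists_heckeCharacter_glOne`), `π' = π ⊗ (θ ∘ det)` (`exists_cuspidalAutomorphicRepData_twist_hecke`),
`hasArchParameter_twist_glOne`, `eventually_hasSatakeParamAt_twist_glOne`. Borel–Jacquet 1979, §5.7;
Arthur–Clozel 1989, Ch. 3, p. 172; Buzzard–Gee 2014, §3.1. [cite: BorelJacquetCorvallis1979, 5.7] -/
theorem stub_twistRealisation :
    ∀ (n : ℕ) [NeZero n] (K : Type) [Field K] [NumberField K]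
      (h1 : isCompact_glFiniteIntegralLevel 1 K) (hcpt : isCompact_glFiniteIntegralLevel n K)
      (π : CuspidalAutomorphicRepData n K hcpt) (χ : CuspidalAutomorphicRepData 1 K h1)
      (P : (K →+* ℂ) → Multiset ℂ) (p : (K →+* ℂ) → ℂ),
      π.1.HasArchParameter P → χ.1.HasArchParameter (fun ι => {p ι}) →
      ∃ π' : CuspidalAutomorphicRepData n K hcpt,
        π'.1.HasArchParameter (fun ι => (P ι).map (· + p ι)) ∧
        ∀ᶠ v in cofinite, ∀ β : Multiset ℂ, π.1.HasSatakeParamAt v β →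
          ∃ c : ℂ, χ.1.HasSatakeParamAt v {c} ∧ π'.1.HasSatakeParamAt v (β.map (fun b => c * b)) := by
  intro n _ K _ _ h1 hcpt π χ P p hP hp
  obtain ⟨θ, hθ⟩ := χ.1.exists_heckeCharacter_glOne
  obtain ⟨π', hW, hW'⟩ := exists_cuspidalAutomorphicRepData_twist_hecke θ π
  exact ⟨π', AutomorphicRepData.hasArchParameter_twist_glOne χ.1 hθ hp hW hW' hP,
    AutomorphicRepData.eventually_hasSatakeParamAt_twist_glOne χ.1 hθ hW hW'⟩

end Summit.Langlands.Langlands.Theorems.RegularTwistCM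

end
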